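import Summits.AtomisticToContinuum.Crystallization.Theorems.FrustratedLawDichotomyThickeningVacancyFloorAll
import Summits.AtomisticToContinuum.Crystallization.Theorems.FrustratedLawDichotomyBindingFloor
import Summits.AtomisticToContinuum.Crystallization.Theorems.LayeredLawsSelectHcp.Negative.PeriodicEnergy

/-!
# FrustratedLawDichotomy · cruxes `AperiodicFrustratedLawGap` / `PeriodicFrustratedLawGap` (stmt-AtomisticToContinuum-27623 / 27624) —
# THE ONE-ATOM FLOORS OF AN EXACT PERIODIC MINIMISER (deterministic census filters)

The Palm law of a periodic configuration `Q` of `ℝ³` (`LayeredLawsSelectHcp.Negative.PeriodicPalmLaw.palmLaw Q`: root at a uniformly chosen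
motif point) is a point-stationary (`pointStationary_palmLaw`) rooted hard-core (`rooted_palmLaw`) probability law of mean root energy `e(Q)`
(`PeriodicEnergy.meanRootEnergy_palmLaw`).  Hence, granted the floor of item 9229, an EXACT PERIODIC MINIMISER — a `δ`-separated periodic `Q`
with `e(Q) ≤ e⋆` (equivalently `e(Q) = e⋆`) — passes Sütő's two one-atom tests AT EVERY SITE, deterministically:

* `periodic_bindingFloor` — for every motif point `x` and every site `p ∈ Q` (seen from `x`: atom `y = p − x` of the view `Q − x`):
  `2·rootEnergy(θ_y(Q − x)) ≤ e⋆ + ½ Σ_{q∈Q} V_LJ⁺(|q − p|)`: every site is bound by at least `|e⋆|` up to half its short-range repulsion;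
* `periodic_vacancyFloor` — for every motif point `x`, every site `p ∈ Q`, every cavity `z` (`B(z, s)` free of `Q − p`, any `s > 0`):
  `e⋆ ≤ Σ_{q∈Q} V_LJ(|q − p − z|) + ½ Σ_{q∈Q} V_LJ⁺(|q − p|)`: no cavity binds a test atom by more than `|e⋆|` (up to half the anchor's repulsion).

CENSUS READING (special side, rung by rung): a periodic textured candidate `Q` with a site bound by less than `|e⋆| ≤ 0.71749` (no compressed bond at
that site), or with a cavity `z` of field `Φ_Q(z) < e⋆_upper ≤ −0.71749` next to an uncompressed site, is NOT an exact minimiser — two certified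
lattice-sum filters needing only an UPPER bound on `e⋆`.  All `[folklore]`.
-/

noncomputable section

namespace Summit.AtomisticToContinuum.Crystallization.Theorems.FrustratedLawDichotomyBindingFloor

open MeasureTheory Metric Set Filter
open scoped ENNReal BigOperators
open Literature.MathematicalPhysics.StatisticalMechanics Literature.Probability.Process
open Summit.AtomisticToContinuum.Crystallization.Theorems.ChargedEnergyGapNegative (E3 eStar)
open Summit.AtomisticToContinuum.Crystallization.Theorems.LayeredLawsSelectHcp.Negative.DiracLaws (meanRootEnergy PointStationary Rooted)
open Summit.AtomisticToContinuum.Crystallization.Theorems.LayeredLawsSelectHcp.Negative.PeriodicPalmLaw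
  (palmLaw viewMeasure of_ae_palmLaw rooted_palmLaw pointStationary_palmLaw)
open Summit.AtomisticToContinuum.Crystallization.Theorems.LayeredLawsSelectHcp.Negative.PeriodicEnergy (meanRootEnergy_palmLaw)
open Summit.AtomisticToContinuum.Crystallization.Theorems.FrustratedLawDichotomyThickening
  (ae_forall_vacancyFloor_all_of_minimising)

variable (Q : PeriodicConfiguration 3)

/-- The Palm law of a periodic configuration, in the vocabulary of the `FrustratedLawDichotomy` files: point-stationary, almost surely rooted
`δ`-hard-core when `Q` is `δ`-separated, with mean root energy `e(Q)`. [folklore] -/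
theorem palmLaw_admissible {δ : ℝ} (hsep : ∀ p ∈ Q.points, ∀ q ∈ Q.points, p ≠ q → δ ≤ dist p q) :
    (∀ᵐ μ ∂(palmLaw Q), IsRootedHardCore δ μ) ∧ IsPointStationaryLaw (palmLaw Q) ∧
      ∫ μ, rootEnergy lennardJones μ ∂(palmLaw Q) = Q.energyPerParticle lennardJones := by
  refine ⟨rooted_palmLaw Q hsep, pointStationary_palmLaw Q, ?_⟩
  rw [← meanRootEnergy_palmLaw Q]
  rfl

/-- **BINDING FLOOR OF AN EXACT PERIODIC MINIMISER.**  Granted the floor of item 9229: if a `δ`-separated (`δ > 0`) periodic configuration `Q` has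
`e(Q) ≤ e⋆`, then for every motif point `x` and every atom `y` of the view `Q − x` (i.e. every site `p = x + y` of `Q`),
`2·rootEnergy(θ_y(Q − x)) ≤ e⋆ + ½ ∫ V_LJ⁺(‖q‖) d(θ_y(Q − x))` — every site of `Q` is bound by at least `|e⋆|` up to half its short-range
repulsion. [folklore] -/
theorem periodic_bindingFloor
    (hU : ∀ δ' : ℝ, 0 < δ' → ∀ P : Measure (Measure E3), IsProbabilityMeasure P → (∀ᵐ μ ∂P, IsRootedHardCore δ' μ) →
      IsPointStationaryLaw P → eStar ≤ ∫ μ, rootEnergy lennardJones μ ∂P)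
    {δ : ℝ} (hδ : 0 < δ) (hsep : ∀ p ∈ Q.points, ∀ q ∈ Q.points, p ≠ q → δ ≤ dist p q)
    (hopt : Q.energyPerParticle lennardJones ≤ eStar) :
    ∀ x ∈ Q.motif, ∀ y : E3, viewMeasure Q x {y} ≠ 0 →
      2 * rootEnergy lennardJones ((viewMeasure Q x).map fun z : E3 => z - y) ≤
        eStar + (∫ z, max (lennardJones ‖z‖) 0 ∂((viewMeasure Q x).map fun z : E3 => z - y)) / 2 := by
  obtain ⟨hcore, hstat, hE⟩ := palmLaw_admissible Q hsep
  exact of_ae_palmLaw Q (ae_forall_bindingFloor_of_minimising hU hδ hcore hstat (hE.le.trans hopt))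

/-- **VACANCY FLOOR OF AN EXACT PERIODIC MINIMISER.**  Granted the floor of item 9229: if a `δ`-separated (`δ > 0`) periodic configuration `Q` has
`e(Q) ≤ e⋆`, then for every motif point `x`, every atom `y` of the view `Q − x`, every site `z` and radius `s > 0` with `B(z, s)` free of atoms of
`θ_y(Q − x)`: `e⋆ ≤ ∫ V_LJ(‖q − z‖) d(θ_y(Q − x)) + ½ ∫ V_LJ⁺(‖q‖) d(θ_y(Q − x))` — no cavity of `Q` binds a test atom by more than `|e⋆|`, up to
half the short-range repulsion of any anchoring site. [folklore] -/
theorem periodic_vacancyFloor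
    (hU : ∀ δ' : ℝ, 0 < δ' → ∀ P : Measure (Measure E3), IsProbabilityMeasure P → (∀ᵐ μ ∂P, IsRootedHardCore δ' μ) →
      IsPointStationaryLaw P → eStar ≤ ∫ μ, rootEnergy lennardJones μ ∂P)
    {δ : ℝ} (hδ : 0 < δ) (hsep : ∀ p ∈ Q.points, ∀ q ∈ Q.points, p ≠ q → δ ≤ dist p q)
    (hopt : Q.energyPerParticle lennardJones ≤ eStar) :
    ∀ x ∈ Q.motif, ∀ y : E3, viewMeasure Q x {y} ≠ 0 → ∀ z : E3, ∀ s : ℝ, 0 < s →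
      ((viewMeasure Q x).map fun w : E3 => w - y) (ball z s) = 0 →
        eStar ≤ (∫ q, lennardJones ‖q - z‖ ∂((viewMeasure Q x).map fun w : E3 => w - y)) +
          (∫ q, max (lennardJones ‖q‖) 0 ∂((viewMeasure Q x).map fun w : E3 => w - y)) / 2 := by
  obtain ⟨hcore, hstat, hE⟩ := palmLaw_admissible Q hsep
  exact of_ae_palmLaw Q (ae_forall_vacancyFloor_all_of_minimising hU hδ hcore hstat (hE.le.trans hopt))

/-- **Contrapositive, census form**: a `δ`-separated periodic configuration with a motif point `x` and a site `y` of `Q − x` violating the binding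
floor has `e⋆ < e(Q)` — it is not an exact Lennard-Jones minimiser (granted the floor of item 9229). [folklore] -/
theorem eStar_lt_energyPerParticle_of_looseSite
    (hU : ∀ δ' : ℝ, 0 < δ' → ∀ P : Measure (Measure E3), IsProbabilityMeasure P → (∀ᵐ μ ∂P, IsRootedHardCore δ' μ) →
      IsPointStationaryLaw P → eStar ≤ ∫ μ, rootEnergy lennardJones μ ∂P)
    {δ : ℝ} (hδ : 0 < δ) (hsep : ∀ p ∈ Q.points, ∀ q ∈ Q.points, p ≠ q → δ ≤ dist p q)
    {x : E3} (hx : x ∈ Q.motif) {y : E3} (hy : viewMeasure Q x {y} ≠ 0)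
    (hloose : eStar + (∫ z, max (lennardJones ‖z‖) 0 ∂((viewMeasure Q x).map fun z : E3 => z - y)) / 2 <
      2 * rootEnergy lennardJones ((viewMeasure Q x).map fun z : E3 => z - y)) :
    eStar < Q.energyPerParticle lennardJones := by
  by_contra hle
  exact absurd (periodic_bindingFloor Q hU hδ hsep (not_lt.1 hle) x hx y hy) (not_le.2 hloose)

/-- **Contrapositive, census form**: a `δ`-separated periodic configuration with a cavity deeper than `e⋆` (beyond half the anchor's repulsion) has
`e⋆ < e(Q)`. [folklore] -/
theorem eStar_lt_energyPerParticle_of_deepHole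
    (hU : ∀ δ' : ℝ, 0 < δ' → ∀ P : Measure (Measure E3), IsProbabilityMeasure P → (∀ᵐ μ ∂P, IsRootedHardCore δ' μ) →
      IsPointStationaryLaw P → eStar ≤ ∫ μ, rootEnergy lennardJones μ ∂P)
    {δ : ℝ} (hδ : 0 < δ) (hsep : ∀ p ∈ Q.points, ∀ q ∈ Q.points, p ≠ q → δ ≤ dist p q)
    {x : E3} (hx : x ∈ Q.motif) {y : E3} (hy : viewMeasure Q x {y} ≠ 0) {z : E3} {s : ℝ} (hs : 0 < s)
    (hvac : ((viewMeasure Q x).map fun w : E3 => w - y) (ball z s) = 0)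
    (hdeep : (∫ q, lennardJones ‖q - z‖ ∂((viewMeasure Q x).map fun w : E3 => w - y)) +
      (∫ q, max (lennardJones ‖q‖) 0 ∂((viewMeasure Q x).map fun w : E3 => w - y)) / 2 < eStar) :
    eStar < Q.energyPerParticle lennardJones := by
  by_contra hle
  exact absurd (periodic_vacancyFloor Q hU hδ hsep (not_lt.1 hle) x hx y hy z s hs hvac) (not_le.2 hdeep)

end Summit.AtomisticToContinuum.Crystallization.Theorems.FrustratedLawDichotomyBindingFloor

end
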